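import Literature.Probability.RandomPlanarGeometry.HexSAWPolygonCellsOmegaLexmin
import Literature.Probability.RandomPlanarGeometry.HexSAWPolygonCellsInterior
import Literature.Probability.RandomPlanarGeometry.HexSAWPolygonJoinAssembly
import Literature.Probability.RandomPlanarGeometry.SAWEdgeSetGeometry
import HarnessLib

/-!
# The step two `q_N(ℍ) ≤ q_{N+2}(ℍ)` (even `N ≥ 12`) from the injectivity of «OMEGA»: the final assembly of the bridge

Topic `Literature/Probability/RandomPlanarGeometry` (lane «pcv-sawmu», a-p4 g22; sequel of XXXI `…CellsOmegaLexmin` (THEOREM V `theoremV`, `isLexmin_omegaImage`,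
`two_le_card_peel`), XX `…CellsInterior` (`exists_bdry_eq`), XXI `…CellsShift`, XVII `…CellsBoundary` (`eq_of_bdry_eq`), and the tree's walk side
`HexSAWPolygonJoinAssembly` (`exists_canonEnd_of_isPolygon`), `HexSAWPolygonLoopEdges` (rigidity, `isPolygon_brickLoopEdges_of_mem_endAt`),
`HexSAWPolygonSupermult` (`card_canonEnd : #canonEnd n = q_{n+1}(ℍ)`), `SAWEdgeSetGeometry` (`shiftEdges_shiftEdges`)).

The map `Φ = stepTwoMap n : canonEnd n → canonEnd (n+2)` (`n = N − 1 ≥ 11`): canonical traversal `ζ` ↦ its bond polygon ↦ the enclosed brick set (even–odd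
interior) ↦ normalised at its bottom-left hexagon ↦ `ι` (OMEGA) ↦ boundary bonds ↦ canonical traversal.  ★ `stepTwoMap_mem_canonEnd` (THEOREM V), ★
`stepTwoMap_injOn_of_omega_injective` — Φ is injective as soon as `ι` is injective on admissible normalised brick sets (THEOREM I of THEOREM-OMEGA-g21, the one
remaining piece) — via `eq_of_bdry_eq`, bottom-left normalisation (`isLexmin_omegaImage`) and translation rigidity of canonical traversals; hence ★★
`hexPolygonNumber_le_add_two_of_omega_injective : (ι injective) → 12 ≤ N → Even N → q_N(ℍ) ≤ q_{N+2}(ℍ)`.  UNCONDITIONAL once THEOREM I lands.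

Sources: N. Madras, G. Slade, *The Self-Avoiding Walk* (1993), §3.2, Theorem 3.2.3 (3.2.3) p. 64 (`q_N ≤ q_{N+2}` on `ℤ^d`) and Definition 3.2.2 / eq. (3.2.1) p. 63
(translation classes) [MadrasSlade1993]; I. Jensen, J. Phys.: Conf. Ser. 42 (2006) 163 [Jensen2006HoneycombPolygons].  Label (lane): LANE THEOREM (conditional form)
for the open combinatorial item `q_N(ℍ) ≤ q_{N+2}(ℍ)` (false at `N = 6, 10`, tree `HexSAWPolygonCensus`); not a literature claim.
-/

open Finset Literature.Probability.LatticeModels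
open Literature.Barriers.CriticalPhenomena.SupercriticalSAW (shiftEdges card_shiftEdges shiftEdges_injective)

namespace Literature.Probability.RandomPlanarGeometry.SAW

namespace HexCell

open HexBW HexBW.PolygonConcat

/-! ### The ingredients as functions -/

open Classical in
/-- The brick set enclosed by a bond polygon (junk `∅` otherwise). [cite: Jensen2006HoneycombPolygons, §2] -/
noncomputable def interiorOf (R : Finset (Sym2 (Site 2))) : Finset Cell :=
  if h : IsPolygon brickWallGraph R then Classical.choose (exists_bdry_eq h) else ∅

open Classical in
/-- [cite: Jensen2006HoneycombPolygons, §2] -/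
theorem interiorOf_spec {R : Finset (Sym2 (Site 2))} (h : IsPolygon brickWallGraph R) : IsBrickSet (interiorOf R) ∧ bdry (interiorOf R) = R := by
  rw [interiorOf, dif_pos h]; exact Classical.choose_spec (exists_bdry_eq h)

open Classical in
/-- The bottom-left hexagon as a function (junk on `∅`). [cite: MadrasSlade1993, Definition 3.2.2 p. 63] -/
noncomputable def botCell (S : Finset Cell) : Cell := if h : S.Nonempty then Classical.choose (exists_isLexmin h) else (0, 0)

open Classical in
/-- [cite: MadrasSlade1993, Definition 3.2.2 p. 63] -/
theorem isLexmin_botCell {S : Finset Cell} (h : S.Nonempty) : IsLexmin S (botCell S) := by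
  rw [botCell, dif_pos h]; exact Classical.choose_spec (exists_isLexmin h)

/-- Normalisation: translate the bottom-left hexagon to the origin. [cite: MadrasSlade1993, Definition 3.2.2 p. 63 (one representative per class)] -/
noncomputable def normalize (S : Finset Cell) : Finset Cell := S.image (shiftCell ![-(botCell S).1, -(botCell S).2])

open Classical in
/-- The canonical traversal of a bond polygon with `M + 1` bonds (junk otherwise). [cite: MadrasSlade1993, Definition 3.2.2 and eq. (3.2.1) p. 63] -/
noncomputable def canonOf (M : ℕ) (E : Finset (Sym2 (Site 2))) : ℕ → Site 2 :=
  if h : IsPolygon brickWallGraph E ∧ #E = M + 1 ∧ 2 ≤ M then Classical.choose (exists_canonEnd_of_isPolygon h.1 h.2.1 h.2.2) else fun _ => 0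

open Classical in
/-- [cite: MadrasSlade1993, Definition 3.2.2 and eq. (3.2.1) p. 63] -/
theorem canonOf_spec {M : ℕ} {E : Finset (Sym2 (Site 2))} (hE : IsPolygon brickWallGraph E) (hM : #E = M + 1) (hM2 : 2 ≤ M) :
    canonOf M E ∈ canonEnd M ∧ ∃ z : Site 2, (z 0 + z 1) % 2 = 0 ∧ brickLoopEdges M (canonOf M E) = shiftEdges z E := by
  have h : IsPolygon brickWallGraph E ∧ #E = M + 1 ∧ 2 ≤ M := ⟨hE, hM, hM2⟩
  rw [canonOf, dif_pos h]
  obtain ⟨hmem, z, hz, he⟩ := Classical.choose_spec (exists_canonEnd_of_isPolygon h.1 h.2.1 h.2.2)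
  exact ⟨hmem, z, hz, he⟩

/-- **Φ**: canonical `(n+1)`-gon ↦ canonical `(n+3)`-gon. [cite: MadrasSlade1993, §3.2, Theorem 3.2.3 (3.2.3)] -/
noncomputable def stepTwoMap (n : ℕ) (ζ : ℕ → Site 2) : ℕ → Site 2 :=
  canonOf (n + 2) (bdry (omegaImage (normalize (interiorOf (brickLoopEdges n ζ)))))

/-! ### The normalised interior of a canonical polygon -/

/-- Data of the normalised interior `S₀` of `ζ ∈ canonEnd n` (`n ≥ 11`): a brick set with polygonal boundary of `n + 1` bonds, a translate of the enclosed set,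
bottom-left hexagon at the origin, base of size `≥ 2`. [cite: MadrasSlade1993, §3.2 (proof of Theorem 3.2.3)] -/
theorem normInterior_spec {n : ℕ} (hn : 11 ≤ n) {ζ : ℕ → Site 2} (hζ : ζ ∈ canonEnd n) :
    let S := interiorOf (brickLoopEdges n ζ)
    let S₀ := normalize S
    IsBrickSet S ∧ bdry S = brickLoopEdges n ζ ∧ Even ((botCell S).1 + (botCell S).2) ∧
      S₀ = S.image (shiftCell ![-(botCell S).1, -(botCell S).2]) ∧ IsBrickSet S₀ ∧
      bdry S₀ = shiftEdges ![-(botCell S).1, -(botCell S).2] (brickLoopEdges n ζ) ∧ IsPolygon brickWallGraph (bdry S₀) ∧ perim S₀ = n + 1 ∧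
      IsLexmin S₀ (0, 0) ∧ 2 ≤ #(peel S₀) := by
  intro S S₀
  have hζe := (mem_canonEnd.1 hζ).1
  have hR : IsPolygon brickWallGraph (brickLoopEdges n ζ) := isPolygon_brickLoopEdges_of_mem_endAt (by omega) hζe
  have hcard : #(brickLoopEdges n ζ) = n + 1 := card_brickLoopEdges_of_mem_endAt (by omega) hζe
  obtain ⟨hSb, hSR⟩ := interiorOf_spec hR
  have hperim : perim S = n + 1 := by rw [← card_bdry hSb]; show #(bdry (interiorOf _)) = _; rw [hSR, hcard]
  have hne : S.Nonempty := by
    by_contra h; rw [not_nonempty_iff_eq_empty] at h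
    have : perim S = 0 := by rw [show S = ∅ from h, perim_empty]
    omega
  have hb := isLexmin_botCell hne
  have hbev : Even ((botCell S).1 + (botCell S).2) := hSb _ hb.1
  have hz : Even ((![-(botCell S).1, -(botCell S).2] : Site 2) 0 + (![-(botCell S).1, -(botCell S).2] : Site 2) 1) := by
    simp only [Matrix.cons_val_zero, Matrix.cons_val_one]
    rw [Int.even_iff] at hbev ⊢; omega
  have hS₀ : S₀ = S.image (shiftCell ![-(botCell S).1, -(botCell S).2]) := rfl
  have hS₀b : IsBrickSet S₀ := isBrickSet_image_shiftCell hz hSb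
  have hbd : bdry S₀ = shiftEdges ![-(botCell S).1, -(botCell S).2] (brickLoopEdges n ζ) := by
    show bdry (normalize S) = _; rw [normalize, bdry_image_shiftCell, show bdry S = bdry (interiorOf (brickLoopEdges n ζ)) from rfl, hSR]
  have hpoly : IsPolygon brickWallGraph (bdry S₀) := by
    rw [hbd]; exact isPolygon_shiftEdges_of_even hR (by rw [Int.even_iff] at hz; exact hz)
  have hper₀ : perim S₀ = n + 1 := by show perim (normalize S) = _; rw [normalize, perim_image_shiftCell, hperim]
  refine ⟨hSb, hSR, hbev, hS₀, hS₀b, hbd, hpoly, hper₀, ?_, two_le_card_peel (by omega)⟩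
  show IsLexmin (normalize S) (0, 0)
  rw [normalize]; exact isLexmin_normalize hb

/-! ### Φ lands in `canonEnd (n+2)` -/

/-- ★ **Φ is well defined** (THEOREM V). [cite: MadrasSlade1993, §3.2, Theorem 3.2.3 (3.2.3)] -/
theorem stepTwoMap_mem_canonEnd {n : ℕ} (hn : 11 ≤ n) {ζ : ℕ → Site 2} (hζ : ζ ∈ canonEnd n) :
    stepTwoMap n ζ ∈ canonEnd (n + 2) ∧ ∃ z : Site 2, (z 0 + z 1) % 2 = 0 ∧
      brickLoopEdges (n + 2) (stepTwoMap n ζ) = shiftEdges z (bdry (omegaImage (normalize (interiorOf (brickLoopEdges n ζ))))) := by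
  obtain ⟨-, -, -, -, hS₀b, -, hpoly, hper₀, -, h2⟩ := normInterior_spec hn hζ
  obtain ⟨hTb, hTp, hTpoly⟩ := theoremV hS₀b hpoly h2
  have hcard : #(bdry (omegaImage (normalize (interiorOf (brickLoopEdges n ζ))))) = (n + 2) + 1 := by rw [card_bdry hTb, hTp, hper₀]
  exact canonOf_spec hTpoly hcard (by omega)

/-! ### Φ is injective when ι is -/

/-- ★ **Injectivity of Φ from the injectivity of ι** on admissible brick sets normalised at the bottom-left hexagon.
[cite: MadrasSlade1993, §3.2, Theorem 3.2.3 (proof: the surgery is one-to-one) and Definition 3.2.2 p. 63 (translation classes)] -/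
theorem stepTwoMap_injOn_of_omega_injective {n : ℕ} (hn : 11 ≤ n)
    (hinj : ∀ S₁ S₂ : Finset Cell, IsBrickSet S₁ → IsBrickSet S₂ → IsPolygon brickWallGraph (bdry S₁) → IsPolygon brickWallGraph (bdry S₂) →
      IsLexmin S₁ (0, 0) → IsLexmin S₂ (0, 0) → 2 ≤ #(peel S₁) → 2 ≤ #(peel S₂) → perim S₁ = n + 1 → perim S₂ = n + 1 →
      omegaImage S₁ = omegaImage S₂ → S₁ = S₂) :
    Set.InjOn (stepTwoMap n) (canonEnd n : Set (ℕ → Site 2)) := by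
  intro ζ₁ h₁ ζ₂ h₂ heq
  rw [mem_coe] at h₁ h₂
  obtain ⟨hS₁b, hS₁R, hb₁, hS₀₁, hS₀₁b, hbd₁, hpoly₁, hper₁, hlex₁, h2₁⟩ := normInterior_spec hn h₁
  obtain ⟨hS₂b, hS₂R, hb₂, hS₀₂, hS₀₂b, hbd₂, hpoly₂, hper₂, hlex₂, h2₂⟩ := normInterior_spec hn h₂
  obtain ⟨-, z₁, hz₁, he₁⟩ := stepTwoMap_mem_canonEnd hn h₁
  obtain ⟨-, z₂, hz₂, he₂⟩ := stepTwoMap_mem_canonEnd hn h₂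
  set S₀₁ := normalize (interiorOf (brickLoopEdges n ζ₁))
  set S₀₂ := normalize (interiorOf (brickLoopEdges n ζ₂))
  obtain ⟨hT₁b, -, hT₁poly⟩ := theoremV hS₀₁b hpoly₁ h2₁
  obtain ⟨hT₂b, -, hT₂poly⟩ := theoremV hS₀₂b hpoly₂ h2₂
  -- the two image boundaries are translates of each other
  rw [heq] at he₁
  have hE : bdry (omegaImage S₀₁) = shiftEdges (z₂ + -z₁) (bdry (omegaImage S₀₂)) := by
    have := congrArg (shiftEdges (-z₁)) (he₁.symm.trans he₂)
    rwa [shiftEdges_shiftEdges, shiftEdges_shiftEdges, add_neg_cancel, shiftEdges_zero] at this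
  -- hence the images are translates, and the bottom-left normalisation kills the translation
  have hw : Even ((z₂ + -z₁) 0 + (z₂ + -z₁) 1) := by
    simp only [Pi.add_apply, Pi.neg_apply]; rw [Int.even_iff]; omega
  rw [← bdry_image_shiftCell] at hE
  have hT : omegaImage S₀₁ = (omegaImage S₀₂).image (shiftCell (z₂ + -z₁)) :=
    eq_of_bdry_eq hT₁b (isBrickSet_image_shiftCell hw hT₂b) hE
  have hl₁ := isLexmin_omegaImage hS₀₁b hpoly₁ h2₁ hlex₁
  have hl₂ := isLexmin_image_shiftCell (z₂ + -z₁) (isLexmin_omegaImage hS₀₂b hpoly₂ h2₂ hlex₂)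
  rw [← hT] at hl₂
  have hw0 : z₂ + -z₁ = 0 := by
    have e := hl₁.unique hl₂
    have e1 : ((0, 0) : Cell).1 = (0 : ℤ) + (z₂ + -z₁) 0 := congrArg Prod.fst e
    have e2 : ((0, 0) : Cell).2 = (0 : ℤ) + (z₂ + -z₁) 1 := congrArg Prod.snd e
    simp only [Pi.add_apply, Pi.neg_apply] at e1 e2
    funext i; fin_cases i
    · show z₂ 0 + -z₁ 0 = 0; simp at e1; omega
    · show z₂ 1 + -z₁ 1 = 0; simp at e2; omega
  rw [hw0, image_shiftCell_zero] at hT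
  -- ι injective ⇒ the normalised interiors coincide
  have hS₀ : S₀₁ = S₀₂ := hinj _ _ hS₀₁b hS₀₂b hpoly₁ hpoly₂ hlex₁ hlex₂ h2₁ h2₂ hper₁ hper₂ hT
  -- hence the bond polygons are translates: rigidity of canonical traversals
  have hR : shiftEdges ![-(botCell (interiorOf (brickLoopEdges n ζ₁))).1, -(botCell (interiorOf (brickLoopEdges n ζ₁))).2] (brickLoopEdges n ζ₁) =
      shiftEdges ![-(botCell (interiorOf (brickLoopEdges n ζ₂))).1, -(botCell (interiorOf (brickLoopEdges n ζ₂))).2] (brickLoopEdges n ζ₂) := by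
    rw [← hbd₁, ← hbd₂]; exact congrArg bdry hS₀
  set v₁ : Site 2 := ![-(botCell (interiorOf (brickLoopEdges n ζ₁))).1, -(botCell (interiorOf (brickLoopEdges n ζ₁))).2]
  set v₂ : Site 2 := ![-(botCell (interiorOf (brickLoopEdges n ζ₂))).1, -(botCell (interiorOf (brickLoopEdges n ζ₂))).2]
  have hR' : shiftEdges (v₂ + -v₁) (brickLoopEdges n ζ₂) = brickLoopEdges n ζ₁ := by
    have := congrArg (shiftEdges (-v₁)) hR
    rw [shiftEdges_shiftEdges, shiftEdges_shiftEdges, add_neg_cancel, shiftEdges_zero] at this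
    exact this.symm
  exact (eq_of_shiftEdges_brickLoopEdges_of_mem_canonEnd (by omega) h₂ h₁ hR').1

/-! ### The count -/

/-- ★★ **`q_N(ℍ) ≤ q_{N+2}(ℍ)` for even `N ≥ 12`, from the injectivity of OMEGA** (THEOREM I of the lane's THEOREM-OMEGA; every other input is in the tree
or in the cell-calculus series). [cite: MadrasSlade1993, §3.2, Theorem 3.2.3 (3.2.3) p. 64] -/
theorem hexPolygonNumber_le_add_two_of_omega_injective {N : ℕ} (hN : 12 ≤ N) (hE : Even N)
    (hinj : ∀ S₁ S₂ : Finset Cell, IsBrickSet S₁ → IsBrickSet S₂ → IsPolygon brickWallGraph (bdry S₁) → IsPolygon brickWallGraph (bdry S₂) →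
      IsLexmin S₁ (0, 0) → IsLexmin S₂ (0, 0) → 2 ≤ #(peel S₁) → 2 ≤ #(peel S₂) → perim S₁ = N → perim S₂ = N →
      omegaImage S₁ = omegaImage S₂ → S₁ = S₂) :
    hexPolygonNumber N ≤ hexPolygonNumber (N + 2) := by
  classical
  obtain ⟨n, rfl⟩ : ∃ n, N = n + 1 := ⟨N - 1, by omega⟩
  rw [← card_canonEnd (by omega), show n + 1 + 2 = (n + 2) + 1 by ring, ← card_canonEnd (by omega)]
  refine card_le_card_of_injOn (stepTwoMap n) (fun ζ hζ => (stepTwoMap_mem_canonEnd (by omega) hζ).1) ?_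
  exact stepTwoMap_injOn_of_omega_injective (by omega) hinj

end HexCell

end Literature.Probability.RandomPlanarGeometry.SAW
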